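import Summits.NavierStokesRegularity.NavierStokesRegularity.Theorems.StrainDoorsFixedDeltaAlignmentLerayHopf
import HarnessLib

/-!
(Tree file 1 of 2 of PART M §M26 — ROUND 68 text N8 of nsreg-p1 g37, `r68/StrainDoorsSliceConcentrationCriterion.lean`
sha256 cca4511d32be01ee (586 l.), split by the landing hand (ns-s30-p1 g6) at the § boundary §M26(c)/(d) to respect the
400-line cap; declarations byte-identical.  THIS file = §M26(a)–(c) under the new module name
`StrainDoorsSliceConcentrationCriterionCore`; file 2 keeps the text's module name `StrainDoorsSliceConcentrationCriterion`
(§M26(d)) and imports this one, so R68 text N9's import line is unchanged.)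

# Strain doors, PART M §M26 — Barker–Prange's Theorem 3 (directions along a SEQUENCE of times) with a
# FIXED `δ₀`, reduced to every-time `L³` concentration at Type-I singular points

ROUND 68 of the `ns-regularity-ideate` p1 line (helper lane of `stmt-NavierStokesRegularity-0056`, rung N0;
nothing here is a claim about Navier–Stokes regularity — Type-I singular points are excluded under a direction
hypothesis AND a concentration door; nothing about Type II).

* §M26(a) typed door `SliceL3Concentration` («X», OPEN as typed): at a singular point of a Leray–Hopf solution
  with the global sup-norm Type-I bound `|u| ≤ M/√(T − t)`, the `L³` norm on the balls `B̄(x₀, R_M √(T − t))`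
  stays `≥ γ_M` for ALL `t` close to `T`, with `γ_M`, `R_M` depending on `M` ONLY.  Barker–Prange 2020 (ARMA)
  Thm 2 (tree: `BarkerPrange2020_thm2_holds`; local-in-time version PROVED in §M27) gives this under the
  MORREY-type bound `‖u(t)‖_{L²(B_r(x̄))} ≤ M₂√r`, which follows from the sup-norm bound only with a
  SOLUTION-DEPENDENT `M₂` (Barker–Prange 2020 p. 5, Seregin–Zajączkowski) — the `M`-only form is the content
  of the door.
* §M26(b) ★★★ `sliceCoherence_smallMass` (PROVED): for `M`, `R' > 0`, `R_m`, `γ > 0` there is `δ > 0` such that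
  every `U ∈ 𝓐_M` (`IsTypeIAncientMild M`) whose vorticity directions at the single slice `s = −4` oscillate by
  `≤ δ` on `B(0,R') ∖ {ω = 0}` has `∫_{B̄(0,R_m)} |U(−4)|³ < γ` — compactness (P2) + the one-slice Liouville
  theorems of §M18 + dominated convergence.
* §M26(c) ★★★ `exists_zoomLimit_at_singular_along₆₈`: the tree's Barker–Prange zoom along a sequence of times,
  re-exporting the VELOCITY convergence at the slice `−4` (the tree keeps only the vorticity).
* §M26(d) ★★★ `frequently_slice_smallMass_of_sliceAligned` (PROVED, the core): `δ₀(M,R,R_m,γ)`-aligned slices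
  `s_n → T` at a SINGULAR point have `∫_{B̄(x₀,R_m√(T−s_n))} |u(s_n)|³ < γ` for infinitely many `n` (zoom along the
  sequence + (b)); ★★★★ `sliceAligned_fixedDelta_not_singular_of_sliceL3Concentration` (PROVED):
  `SliceL3Concentration →` for every `M`, `R > 0` there is `δ₀(M,R) > 0` such that a Leray–Hopf solution with
  the global Type-I bound whose vorticity directions satisfy `|ξ(x,s_n) − ξ(y,s_n)| ≤ δ₀` for `x, y ∈
  B(x₀, R√(T − s_n)) ∩ {|ω| > d}` along SOME sequence `s_n → T` is not singular at `(T,x₀)` — Barker–Prange's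
  Theorem 3 with the modulus `η` replaced by a fixed `δ₀(M,R)`, CONDITIONAL on the door X.  The UNCONDITIONAL
  version with `δ₀(M,M₂,R)` under the additional Morrey-type Type-I bound is §M27
  (`StrainDoorsMorreyTypeIFixedDelta`).

Honest status: the `M`-only (d) is conditional on X, which is OPEN as typed (see (a)); `δ₀` is ineffective
(contradiction + compactness).  Why a door at all: with a FIXED `δ₀` the blow-up limit along the sequence is only
`δ₀`-coherent at ONE slice (a modulus `η(|x − y|)` would make it PARALLEL there, whence Barker–Prange's Liouville
step); a second compactness–contradiction step à la Giga–Miura then needs a QUANTITATIVE non-degeneracy of the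
limit slice with constants fixed before the solution — every-time `L³` concentration is exactly that.

References: Barker–Prange, Arch. Ration. Mech. Anal. 235 (2020) (arXiv:1812.09115) Thm 2; Barker–Prange,
arXiv:1906.08225, Thm 3 and §4; Giga–Miura, Comm. Math. Phys. 303 (2011) Thm 1.1; Seregin–Šverák 2009 Thm 2.8;
Albritton–Barker, J. Math. Fluid Mech. 21 (2019) Lemma 2.5.
-/

noncomputable section

-- the summit and its single problem share the name `NavierStokesRegularity` (D-0017 nested layout)
set_option linter.dupNamespace false

open MeasureTheory Set Function Filter Metric Real InnerProductSpace
open _root_.Topology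
open scoped ENNReal NNReal RealInnerProductSpace ContDiff
open Literature.Analysis Literature.Analysis.FluidPDE Literature.Analysis.FluidPDE.LocalTypeIBlowup

namespace Summit.NavierStokesRegularity.NavierStokesRegularity.Theorems.StrainDoors

/-! ### §M26(a) The door X: every-time `L³` concentration at Type-I singular points -/

/-- **Door X** «SliceL3Concentration» (typed; OPEN as typed — NOT proved here).  For every Type-I rate `M`
there are `γ > 0` and `R_m > 0` (depending on `M` ONLY) such that: if `(u,p)` is a classical solution of the
unit-viscosity unforced Navier–Stokes system on `ℝ³ × [0,T)`, Leray–Hopf on `[0,T)`, with the global Type-I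
bound `|u(t,x)| ≤ M/√(T − t)` on `(0,T)`, and `(T,x₀)` is a singular point, then for all `t` in some left
neighbourhood of `T` the `L³` norm concentrates: `γ ≤ ∫_{B̄(x₀, R_m √(T − t))} |u(t,x)|³ dx`.
What is known: Barker–Prange 2020 (ARMA) Thm 2 (tree: `BarkerPrange2020_thm2_holds`; the local-in-time
Leray–Hopf version is PROVED in §M27 as `l3_concentration_of_morreyTypeI_local`) gives this with universal
`γ` and `R_m = 2/√S(M₂)` under the MORREY-type Type-I bound `sup_x̄ ‖u(t)‖_{L²(B_r(x̄))} ≤ M₂√r`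
(`T − r² < t < T`); the sup-norm bound yields such an `M₂` only depending on the SOLUTION (Barker–Prange 2020
p. 5, after Seregin–Zajączkowski / Seregin 2018), and at the radius `√((T − t)/S)` the pointwise bound gives
`M₂ ≈ M S^{-1/2}` while `S = S(M₂)` decays faster than `M₂^{-2}` — no fixed point.  Why it might fail: an
`M`-only `(γ, R_m)` is a uniform non-degeneracy statement over the whole sup-norm Type-I class, of the same
flavour as (P1) but at EVERY time near the singularity; no counterexample mechanism is known either.
Sources (in prose on purpose — a parameterless typed door must not carry a cite tag, or the gate files it as
a Literature fact): Barker–Prange 2020 (ARMA 236), Thm 2 and p. 5 (arXiv:1812.09115 pp. 4–5); Kang–Miura–Tsai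
2021, Thm 1.6(ii) and Rem 1.7(3) (arXiv:2006.13145 p. 5); Seregin–Šverák 2009, Thm 2.8.  [new-as-typed] -/
def SliceL3Concentration : Prop :=
  ∀ M : ℝ, ∃ γ Rm : ℝ, 0 < γ ∧ 0 < Rm ∧
    ∀ (T : ℝ) (u : ℝ → EuclideanSpace ℝ (Fin 3) → EuclideanSpace ℝ (Fin 3))
      (p : ℝ → EuclideanSpace ℝ (Fin 3) → ℝ), 0 < T →
      IsClassicalNSSolutionOn (Ico 0 T) 1 0 u p → IsLerayHopfOn T 1 0 (u 0) u →
      (∀ t ∈ Ioo 0 T, ∀ x : EuclideanSpace ℝ (Fin 3), ‖u t x‖ ≤ M / Real.sqrt (T - t)) →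
      ∀ x₀ : EuclideanSpace ℝ (Fin 3), IsBackwardSingularPoint u (T, x₀) →
        ∃ t₁ : ℝ, t₁ < T ∧ ∀ t ∈ Ioo t₁ T,
          γ ≤ ∫ x in closedBall x₀ (Rm * Real.sqrt (T - t)), ‖u t x‖ ^ 3

/-! ### §M26(b) One-slice coherence forces small `L³` mass (compactness + §M18) -/

/-- ★★★ **ONE-SLICE COHERENCE ⇒ SMALL MASS.**  For `M`, `R' > 0`, `R_m` and `γ > 0` there is `δ > 0` such
that every `U ∈ 𝓐_M` whose vorticity directions at the slice `s = −4` satisfy `|ξ(y') − ξ(y)| ≤ δ` for all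
`y, y' ∈ B(0,R')` off the zero set of `ω(−4)` has `∫_{B̄(0,R_m)} |U(−4,y)|³ dy < γ`.
Proof: otherwise `δ_j = 1/(j+1)`-coherent `U_j ∈ 𝓐_M` with mass `≥ γ`; by (P2) (`typeIAncientCompactness_holds`)
a subsequence converges pointwise with its curls to `W ∈ 𝓐_M`; the mass passes to the limit (dominated
convergence, `|U_j(−4)| ≤ M/2`); if `ω_W(−4) ≠ 0` somewhere in `B(0,R')` the directions of `W(−4)` are
constant on the open set `B(0,R') ∩ {ω_W(−4) ≠ 0}` and §M18
(`eq_zero_of_typeIAncientMild_of_curl_parallel_on_open`) gives `W ≡ 0`, absurd; otherwise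
`ω_W(−4) ≡ 0` on `B(0,R')` and §M18 (`eq_zero_of_typeIAncientMild_of_curl_eq_zero_on_open`) gives `W ≡ 0`,
contradicting the mass `≥ γ > 0`.
[cite: GigaMiura2011, Thm 1.1/Lemma 3.1 (compactness–contradiction); BarkerPrange2020Alignment, §4 Step 3] -/
theorem sliceCoherence_smallMass (M : ℝ) {R' : ℝ} (hR' : 0 < R') (Rm : ℝ) {γ : ℝ} (hγ : 0 < γ) :
    ∃ δ : ℝ, 0 < δ ∧
      ∀ U : ℝ → EuclideanSpace ℝ (Fin 3) → EuclideanSpace ℝ (Fin 3), IsTypeIAncientMild M U →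
        (∀ y y' : EuclideanSpace ℝ (Fin 3), y ∈ ball (0 : EuclideanSpace ℝ (Fin 3)) R' →
          y' ∈ ball (0 : EuclideanSpace ℝ (Fin 3)) R' → curl (U (-4)) y ≠ 0 → curl (U (-4)) y' ≠ 0 →
            ‖vorticityDirection (curl (U (-4))) y' - vorticityDirection (curl (U (-4))) y‖ ≤ δ) →
        ∫ y in closedBall (0 : EuclideanSpace ℝ (Fin 3)) Rm, ‖U (-4) y‖ ^ 3 < γ := by
  by_contra hneg
  push Not at hneg
  have hF := fun j : ℕ => hneg (1 / ((j : ℝ) + 1)) (by positivity)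
  choose U hUA hcoh hmass using hF
  have h4 : (-4 : ℝ) < 0 := by norm_num
  -- (1) compactness (P2)
  obtain ⟨W, φ, hφ, hW, hlim⟩ := typeIAncientCompactness_holds M U hUA
  -- (2) the mass passes to the limit
  have hcU : ∀ j, Continuous (U j (-4)) := fun j =>
    ((hUA j).contDiff_slice h4).continuous
  have hcW4 : Continuous (W (-4)) := (hW.contDiff_slice h4).continuous
  have hmassW : γ ≤ ∫ y in closedBall (0 : EuclideanSpace ℝ (Fin 3)) Rm, ‖W (-4) y‖ ^ 3 := by
    have hfin : IsFiniteMeasure (volume.restrict (closedBall (0 : EuclideanSpace ℝ (Fin 3)) Rm)) :=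
      isFiniteMeasure_restrict.2 measure_closedBall_lt_top.ne
    have hT : Tendsto (fun j => ∫ y in closedBall (0 : EuclideanSpace ℝ (Fin 3)) Rm, ‖U (φ j) (-4) y‖ ^ 3)
        atTop (𝓝 (∫ y in closedBall (0 : EuclideanSpace ℝ (Fin 3)) Rm, ‖W (-4) y‖ ^ 3)) := by
      refine tendsto_integral_of_dominated_convergence (fun _ => (M / Real.sqrt (-(-4 : ℝ))) ^ 3)
        (fun j => ((hcU (φ j)).norm.pow 3).aestronglyMeasurable) (integrable_const _) ?_ ?_
      · intro j
        refine Eventually.of_forall fun y => ?_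
        rw [Real.norm_of_nonneg (pow_nonneg (norm_nonneg _) 3)]
        exact pow_le_pow_left₀ (norm_nonneg _) ((hUA (φ j)).norm_le h4 y) 3
      · exact Eventually.of_forall fun y => (((hlim (-4) h4 y).1).norm).pow 3
    exact ge_of_tendsto hT (Eventually.of_forall fun j => hmass (φ j))
  -- (3) `W ≡ 0` is impossible
  have hWne : ¬ (∀ t : ℝ, t < 0 → ∀ x : EuclideanSpace ℝ (Fin 3), W t x = 0) := by
    intro hzero
    have hW0 : W (-4) = 0 := funext fun x => hzero _ h4 x
    have h0 : ∫ y in closedBall (0 : EuclideanSpace ℝ (Fin 3)) Rm, ‖W (-4) y‖ ^ 3 = 0 := by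
      simp [hW0]
    linarith [hmassW]
  -- (4) dichotomy at the slice `−4`
  by_cases hex : ∃ y₀ ∈ ball (0 : EuclideanSpace ℝ (Fin 3)) R', curl (W (-4)) y₀ ≠ 0
  · obtain ⟨y₀, hy₀, he0⟩ := hex
    obtain ⟨e, he_def⟩ : ∃ e : EuclideanSpace ℝ (Fin 3), curl (W (-4)) y₀ = e := ⟨_, rfl⟩
    have he : e ≠ 0 := by rw [← he_def]; exact he0
    have hcW : Continuous (curl (W (-4))) := by
      have h3 : ContDiff ℝ 1 (W (-4)) := (hW.contDiff_slice h4).of_le (by norm_cast)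
      exact (contDiff_curl (n := 0) (by exact_mod_cast h3)).continuous
    have hUo : IsOpen (ball (0 : EuclideanSpace ℝ (Fin 3)) R' ∩ {y | curl (W (-4)) y ≠ 0}) :=
      isOpen_ball.inter (isOpen_ne_fun hcW continuous_const)
    have h0U : y₀ ∈ ball (0 : EuclideanSpace ℝ (Fin 3)) R' ∩ {y | curl (W (-4)) y ≠ 0} := ⟨hy₀, he0⟩
    -- directions pass to the limit off the zero set and are constant on the open set
    have hT : ∀ y : EuclideanSpace ℝ (Fin 3), curl (W (-4)) y ≠ 0 →
        Tendsto (fun j => vorticityDirection (curl (U (φ j) (-4))) y) atTop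
          (𝓝 (vorticityDirection (curl (W (-4))) y)) := by
      intro y hy
      have h1 := (hlim (-4) h4 y).2
      have h3 := (continuousAt_inv_norm_smul hy).tendsto.comp h1
      simpa only [Function.comp_def, vorticityDirection_apply] using h3
    have hconst : ∀ y ∈ ball (0 : EuclideanSpace ℝ (Fin 3)) R' ∩ {y | curl (W (-4)) y ≠ 0},
        vorticityDirection (curl (W (-4))) y = vorticityDirection (curl (W (-4))) y₀ := by
      intro y hy
      have hy0 : curl (W (-4)) y ≠ 0 := hy.2
      have hA : ∀ᶠ j in atTop, curl (U (φ j) (-4)) y ≠ 0 := ((hlim (-4) h4 y).2).eventually_ne hy0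
      have hB : ∀ᶠ j in atTop, curl (U (φ j) (-4)) y₀ ≠ 0 := ((hlim (-4) h4 y₀).2).eventually_ne he0
      have hev : ∀ᶠ j in atTop,
          ‖vorticityDirection (curl (U (φ j) (-4))) y - vorticityDirection (curl (U (φ j) (-4))) y₀‖ ≤
            1 / ((j : ℝ) + 1) := by
        filter_upwards [hA, hB] with j hjA hjB
        refine (hcoh (φ j) y₀ y hy₀ hy.1 hjB hjA).trans (one_div_le_one_div_of_le (by positivity) ?_)
        exact_mod_cast Nat.succ_le_succ (hφ.id_le j)
      have hle : ‖vorticityDirection (curl (W (-4))) y - vorticityDirection (curl (W (-4))) y₀‖ ≤ 0 :=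
        le_of_tendsto_of_tendsto ((hT y hy0).sub (hT y₀ he0)).norm
          (tendsto_one_div_add_atTop_nhds_zero_nat (𝕜 := ℝ)) hev
      exact sub_eq_zero.1 (norm_le_zero_iff.1 hle)
    -- `curl W(−4) ∥ e` on the open set
    have hpar : ∀ y ∈ ball (0 : EuclideanSpace ℝ (Fin 3)) R' ∩ {y | curl (W (-4)) y ≠ 0},
        ∃ a : ℝ, curl (W (-4)) y = a • e := by
      intro y hy
      have hy0 : curl (W (-4)) y ≠ 0 := hy.2
      have hξ := hconst y hy
      rw [vorticityDirection_apply, vorticityDirection_apply, he_def] at hξ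
      refine ⟨‖curl (W (-4)) y‖ * ‖e‖⁻¹, ?_⟩
      calc curl (W (-4)) y
          = ‖curl (W (-4)) y‖ • (‖curl (W (-4)) y‖⁻¹ • curl (W (-4)) y) := by
            rw [smul_smul, mul_inv_cancel₀ (norm_ne_zero_iff.2 hy0), one_smul]
        _ = ‖curl (W (-4)) y‖ • (‖e‖⁻¹ • e) := by rw [hξ]
        _ = (‖curl (W (-4)) y‖ * ‖e‖⁻¹) • e := by rw [smul_smul]
    exact hWne (eq_zero_of_typeIAncientMild_of_curl_parallel_on_open hW h4 hUo ⟨y₀, h0U⟩ he hpar)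
  · push Not at hex
    exact hWne (eq_zero_of_typeIAncientMild_of_curl_eq_zero_on_open hW h4 isOpen_ball
      ⟨0, mem_ball_self hR'⟩ hex)

/-! ### §M26(c) Change of variables for the zoomed `L³` mass, and the zoom along a sequence of times -/

/-- `∫_{B̄(0,r)} |λ g(x₀ + λ y)|³ dy = ∫_{B̄(x₀, λ r)} |g(x)|³ dx` (`λ > 0`; scale invariance of the `L³`
norm in `ℝ³`). -/
theorem setIntegral_norm_zoom_pow_three (g : EuclideanSpace ℝ (Fin 3) → EuclideanSpace ℝ (Fin 3))
    (x₀ : EuclideanSpace ℝ (Fin 3)) {lam : ℝ} (hlam : 0 < lam) {r : ℝ} (hr : 0 ≤ r) :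
    ∫ y in closedBall (0 : EuclideanSpace ℝ (Fin 3)) r, ‖lam • g (x₀ + lam • y)‖ ^ 3 =
      ∫ x in closedBall x₀ (lam * r), ‖g x‖ ^ 3 := by
  have hfin : Module.finrank ℝ (EuclideanSpace ℝ (Fin 3)) = 3 := finrank_euclideanSpace_fin
  -- pull out `λ³`
  have h1 : ∀ y : EuclideanSpace ℝ (Fin 3), ‖lam • g (x₀ + lam • y)‖ ^ 3 = lam ^ 3 * ‖g (x₀ + lam • y)‖ ^ 3 := by
    intro y; rw [norm_smul, Real.norm_of_nonneg hlam.le, mul_pow]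
  simp_rw [h1, integral_const_mul]
  -- dilate
  have h2 : ∫ y in closedBall (0 : EuclideanSpace ℝ (Fin 3)) r, ‖g (x₀ + lam • y)‖ ^ 3 =
      (lam ^ 3)⁻¹ * ∫ z in closedBall (0 : EuclideanSpace ℝ (Fin 3)) (lam * r), ‖g (x₀ + z)‖ ^ 3 := by
    have h := Measure.setIntegral_comp_smul_of_pos volume (fun z : EuclideanSpace ℝ (Fin 3) => ‖g (x₀ + z)‖ ^ 3)
      (closedBall (0 : EuclideanSpace ℝ (Fin 3)) r) hlam
    rw [smul_closedBall _ _ hr, smul_zero, Real.norm_of_nonneg hlam.le, hfin, smul_eq_mul] at h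
    exact h
  rw [h2, ← mul_assoc, mul_inv_cancel₀ (pow_ne_zero 3 hlam.ne'), one_mul]
  -- translate
  have h3 : ∀ z : EuclideanSpace ℝ (Fin 3),
      (closedBall (0 : EuclideanSpace ℝ (Fin 3)) (lam * r)).indicator
          (fun z : EuclideanSpace ℝ (Fin 3) => ‖g (x₀ + z)‖ ^ 3) z =
        (closedBall x₀ (lam * r)).indicator (fun x => ‖g x‖ ^ 3) (x₀ + z) := by
    intro z
    by_cases hz : z ∈ closedBall (0 : EuclideanSpace ℝ (Fin 3)) (lam * r)
    · have hz' : x₀ + z ∈ closedBall x₀ (lam * r) := by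
        rw [mem_closedBall, dist_eq_norm, add_sub_cancel_left]; exact mem_closedBall_zero_iff.1 hz
      rw [indicator_of_mem hz, indicator_of_mem hz']
    · have hz' : x₀ + z ∉ closedBall x₀ (lam * r) := by
        intro h; apply hz
        rw [mem_closedBall, dist_eq_norm, add_sub_cancel_left] at h; exact mem_closedBall_zero_iff.2 h
      rw [indicator_of_notMem hz, indicator_of_notMem hz']
  rw [← integral_indicator measurableSet_closedBall, ← integral_indicator measurableSet_closedBall]
  simp_rw [h3]
  exact integral_add_left_eq_self (fun x => (closedBall x₀ (lam * r)).indicator (fun x => ‖g x‖ ^ 3) x) x₀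


/-- ★★★ **THE BARKER–PRANGE ZOOM ALONG A SEQUENCE OF TIMES, WITH THE VELOCITY.**  The tree's
`exists_zoomLimit_at_singular_along` (Barker–Prange §4 Steps 1–3: at a singular point `(T,x₀)` of a
Leray–Hopf solution with the global Type-I bound, the zooms with scales `√(T − s_n)/2` converge along a
subsequence to some `U ∈ 𝓐_M`), re-exporting at the slice `−4` BOTH the velocity convergence
`(√(T − s)/2) u(s, x₀ + (√(T − s)/2) y) → U(−4,y)` and the vorticity convergence
`((T − s)/4) ω(s, x₀ + (√(T − s)/2) y) → ω_U(−4,y)` (`s = s_{φ(j)}`); the proof is the tree's, verbatim, keeping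
the velocity limit it discards.
[cite: BarkerPrange2020Alignment, §4 Steps 1–3 (arXiv:1906.08225 pp. 16–17); SereginSverak2009, Thm 2.8;
AlbrittonBarker2019, Lemma 2.5] -/
theorem exists_zoomLimit_at_singular_along₆₈
    {T M : ℝ} {u : ℝ → (EuclideanSpace ℝ (Fin 3)) → (EuclideanSpace ℝ (Fin 3))}
    {p : ℝ → (EuclideanSpace ℝ (Fin 3)) → ℝ} (hT : 0 < T)
    (hcl : IsClassicalNSSolutionOn (Ico 0 T) 1 0 u p) (hLH : IsLerayHopfOn T 1 0 (u 0) u)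
    (hI : ∀ t ∈ Ioo 0 T, ∀ x : EuclideanSpace ℝ (Fin 3), ‖u t x‖ ≤ M / Real.sqrt (T - t))
    {x₀ : EuclideanSpace ℝ (Fin 3)} (hsing : IsBackwardSingularPoint u (T, x₀))
    {s : ℕ → ℝ} (hs : ∀ n, s n ∈ Ioo 0 T) (hsT : Tendsto s atTop (𝓝 T)) :
    ∃ φ : ℕ → ℕ, StrictMono φ ∧
      ∃ U : ℝ → (EuclideanSpace ℝ (Fin 3)) → (EuclideanSpace ℝ (Fin 3)), IsTypeIAncientMild M U ∧
        (∀ y : EuclideanSpace ℝ (Fin 3),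
          Tendsto (fun j => (Real.sqrt (T - s (φ j)) / 2) • u (s (φ j)) (x₀ + (Real.sqrt (T - s (φ j)) / 2) • y))
            atTop (𝓝 (U (-4) y))) ∧
        ∀ y : EuclideanSpace ℝ (Fin 3),
          Tendsto (fun j => ((T - s (φ j)) / 4) • curl (u (s (φ j))) (x₀ + (Real.sqrt (T - s (φ j)) / 2) • y))
            atTop (𝓝 (curl (U (-4)) y)) := by
  -- ## Step 1: the class at the vertex and `𝐈 < ∞` from the rate
  set ρ : ℝ := Real.sqrt T / 2 with hρdef
  have hρ : 0 < ρ := by rw [hρdef]; positivity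
  have hρ2 : ρ ^ 2 = T / 4 := by
    rw [hρdef, div_pow, Real.sq_sqrt hT.le]; norm_num
  have hρT : ρ ^ 2 ≤ T := by rw [hρ2]; linarith
  set pg : ℝ → (EuclideanSpace ℝ (Fin 3)) → ℝ := fun t x => p t x - (p t 0 - normalisedPressure (u t) 0) with hpg
  have hballρ : IsSuitableWeakSolutionInBall ρ ((T, x₀) : ℝ × (EuclideanSpace ℝ (Fin 3))) u pg :=
    SereginSverak2002.isSuitableWeakSolutionInBall_vertex hT hcl hLH x₀ hρT
  -- zoom by `ρ` to the unit ball
  set ut : ℝ → (EuclideanSpace ℝ (Fin 3)) → (EuclideanSpace ℝ (Fin 3)) := ρ • stPull (ρ ^ 2) ρ T x₀ u with hut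
  set pt : ℝ → (EuclideanSpace ℝ (Fin 3)) → ℝ := ρ ^ 2 • stPull (ρ ^ 2) ρ T x₀ pg with hpt
  have hball1 : IsSuitableWeakSolutionInBall 1 (0 : ℝ × (EuclideanSpace ℝ (Fin 3))) ut pt := by
    have h := hballρ.zoom hρ
    simpa only using h
  obtain ⟨G₁, hG₁, -⟩ := hball1.2.2.1
  have hrate1 : ∀ t' x', (t', x') ∈ parabolicCylinder 1 (0 : ℝ × (EuclideanSpace ℝ (Fin 3))) →
      ‖ut t' x'‖ ≤ M / Real.sqrt ((0 : ℝ × (EuclideanSpace ℝ (Fin 3))).1 - t') := by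
    intro t' x' hmem
    rw [mem_parabolicCylinder] at hmem
    simp only [Prod.fst_zero, Prod.snd_zero, zero_sub, one_pow, dist_zero_right] at hmem
    obtain ⟨⟨ht1, ht0⟩, -⟩ := hmem
    have ht' : 0 < -t' := by linarith
    have hτ : T + ρ ^ 2 * t' ∈ Ioo 0 T := by
      rw [hρ2]
      constructor <;> nlinarith
    have h := hI _ hτ (x₀ + ρ • x')
    have hsq : Real.sqrt (T - (T + ρ ^ 2 * t')) = ρ * Real.sqrt (-t') := by
      rw [show T - (T + ρ ^ 2 * t') = ρ ^ 2 * (-t') by ring, Real.sqrt_mul (sq_nonneg _), Real.sqrt_sq hρ.le]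
    rw [hsq] at h
    have hspos : 0 < Real.sqrt (-t') := Real.sqrt_pos.2 ht'
    simp only [Prod.fst_zero, zero_sub]
    show ‖(ρ • stPull (ρ ^ 2) ρ T x₀ u) t' x'‖ ≤ M / Real.sqrt (-t')
    rw [smul_stPull_apply, norm_smul, Real.norm_of_nonneg hρ.le, le_div_iff₀ hspos]
    have h' := (le_div_iff₀ (mul_pos hρ hspos)).1 h
    calc ρ * ‖u (T + ρ ^ 2 * t') (x₀ + ρ • x')‖ * Real.sqrt (-t')
        = ‖u (T + ρ ^ 2 * t') (x₀ + ρ • x')‖ * (ρ * Real.sqrt (-t')) := by ring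
      _ ≤ M := h'
  have hIhalf : typeIBound (parabolicCylinder (1 / 2) (0 : ℝ × (EuclideanSpace ℝ (Fin 3)))) ut pt G₁ < ⊤ :=
    albrittonBarker2019_lemma_2_5_rate_holds 0 ut pt M hball1 hrate1 G₁ hG₁ (1 / 2) (by norm_num) (by norm_num)
  have hballh : IsSuitableWeakSolutionInBall (1 / 2) (0 : ℝ × (EuclideanSpace ℝ (Fin 3))) ut pt :=
    SuitableCompactness.isSuitableWeakSolutionInBall_of_le_radius hball1 (by norm_num) (by norm_num)
  have hle : parabolicCylinderOpens (1 / 2) (0 : ℝ × (EuclideanSpace ℝ (Fin 3))) ≤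
      parabolicCylinderOpens 1 (0 : ℝ × (EuclideanSpace ℝ (Fin 3))) :=
    parabolicCylinder_mono (by norm_num) (by norm_num) _
  have hwgh : HasWeakSpatialGradientOn (parabolicCylinderOpens (1 / 2) (0 : ℝ × (EuclideanSpace ℝ (Fin 3)))) ut G₁ :=
    hG₁.mono hle
  have hrateh : ∀ (t' : ℝ) (x' : EuclideanSpace ℝ (Fin 3)),
      (t', x') ∈ parabolicCylinder (1 / 2) (0 : ℝ × (EuclideanSpace ℝ (Fin 3))) →
        ‖ut t' x'‖ ≤ M / Real.sqrt ((0 : ℝ × (EuclideanSpace ℝ (Fin 3))).1 - t') :=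
    fun t' x' h => hrate1 t' x' (hle h)
  -- continuity of the zoom on the half ball (the classical solution is smooth on `[0, T) × ℝ³`)
  have hmaps : MapsTo (stAffine (ρ ^ 2) ρ T x₀)
      (parabolicCylinder (1 / 2) (0 : ℝ × (EuclideanSpace ℝ (Fin 3)))) (Ico 0 T ×ˢ univ) := by
    rintro ⟨t', x'⟩ hmem
    rw [mem_parabolicCylinder] at hmem
    simp only [Prod.fst_zero, Prod.snd_zero, zero_sub, dist_zero_right] at hmem
    obtain ⟨⟨ht1, ht0⟩, -⟩ := hmem
    rw [stAffine_apply]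
    refine ⟨⟨?_, ?_⟩, mem_univ _⟩
    · rw [hρ2]; nlinarith
    · rw [hρ2]; nlinarith
  have hconth : ContinuousOn (uncurry ut) (parabolicCylinder (1 / 2) (0 : ℝ × (EuclideanSpace ℝ (Fin 3)))) := by
    have e : uncurry ut = fun w => ρ • (uncurry u ∘ stAffine (ρ ^ 2) ρ T x₀) w := by
      funext w
      rfl
    rw [e]
    exact ContinuousOn.const_smul
      (hcl.smooth_velocity.continuousOn.comp (continuous_stAffine _ _ _ _).continuousOn hmaps) ρ
  -- the vertex stays singular
  have hst1 : stAffine (ρ ^ 2) ρ T x₀ (0 : ℝ × (EuclideanSpace ℝ (Fin 3))) =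
      ((T, x₀) : ℝ × (EuclideanSpace ℝ (Fin 3))) := by
    rw [show (0 : ℝ × (EuclideanSpace ℝ (Fin 3))) = ((0 : ℝ), (0 : EuclideanSpace ℝ (Fin 3))) from rfl,
      stAffine_apply, mul_zero, add_zero, smul_zero, add_zero]
  have hsing1 : IsBackwardSingularPoint ut 0 := by
    intro r hr
    rw [hut, eLpNorm_top_nsZoom hρ T x₀ r 0 u, hst1, hsing (ρ * r) (mul_pos hρ hr),
      ENNReal.mul_top (ENNReal.ofReal_pos.2 hρ).ne']
  -- ## Steps 2–3: the zoom along the scales `R n = √(T - s n) / (2ρ)`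
  set R : ℕ → ℝ := fun n => Real.sqrt (T - s n) / (2 * ρ) with hRdef
  have hTs : ∀ n, 0 < T - s n := fun n => by linarith [(hs n).2]
  have hR : ∀ n, 0 < R n := fun n => by
    rw [hRdef]
    exact div_pos (Real.sqrt_pos.2 (hTs n)) (by positivity)
  have hR0 : Tendsto R atTop (𝓝 0) := by
    have h1 : Tendsto (fun n => T - s n) atTop (𝓝 0) := by
      have h : Tendsto (fun n => T - s n) atTop (𝓝 (T - T)) := tendsto_const_nhds.sub hsT
      rwa [sub_self] at h
    have h2 : Tendsto (fun n => Real.sqrt (T - s n)) atTop (𝓝 0) := by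
      have h := (Real.continuous_sqrt.tendsto 0).comp h1
      rwa [Function.comp_def, Real.sqrt_zero] at h
    have h3 := h2.div_const (2 * ρ)
    rwa [zero_div] at h3
  obtain ⟨φ, hφ, U, P, H, hU, hswU, hwgU, hIU, hsingU, -, hcurl⟩ :=
    exists_typeIAncientMild_zoomLimit (z₀ := (0 : ℝ × (EuclideanSpace ℝ (Fin 3)))) (by norm_num : (0 : ℝ) < 1 / 2)
      hballh hwgh hIhalf hconth hrateh hsing1 hR hR0
  obtain ⟨φ, hφ, U, P, H, hU, -, -, -, -, hconv, hcurl⟩ :=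
    exists_typeIAncientMild_zoomLimit (z₀ := (0 : ℝ × (EuclideanSpace ℝ (Fin 3)))) (by norm_num : (0 : ℝ) < 1 / 2)
      hballh hwgh hIhalf hconth hrateh hsing1 hR hR0
  have hRsq : ∀ j, R (φ j) ^ 2 = (T - s (φ j)) / (4 * ρ ^ 2) := fun j => by
    rw [hRdef]
    dsimp only
    rw [div_pow, Real.sq_sqrt (hTs (φ j)).le]
    ring
  have e1 : ∀ j, R (φ j) ^ 2 * (ρ * ρ) = (T - s (φ j)) / 4 := fun j => by
    rw [hRsq]
    field_simp
  have e2 : ∀ j, T + ρ ^ 2 * (R (φ j) ^ 2 * (-4)) = s (φ j) := fun j => by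
    rw [hRsq]
    field_simp
    ring
  have e3 : ∀ j, ρ * R (φ j) = Real.sqrt (T - s (φ j)) / 2 := fun j => by
    rw [hRdef]
    dsimp only
    field_simp
  refine ⟨φ, hφ, U, hU, fun y => ?_, fun y => ?_⟩
  · have h := hconv (-4) (by norm_num) y
    refine h.congr fun j => ?_
    simp only [Prod.fst_zero, Prod.snd_zero, zero_add]
    show R (φ j) • (ρ • stPull (ρ ^ 2) ρ T x₀ u) (R (φ j) ^ 2 * (-4)) (R (φ j) • y) = _
    rw [smul_stPull_apply, smul_smul, smul_smul, e2, mul_comm (R (φ j)) ρ, e3]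
  · have h := hcurl (-4) (by norm_num) y
    refine h.congr fun j => ?_
    simp only [Prod.fst_zero, Prod.snd_zero, zero_add]
    show R (φ j) ^ 2 • curl ((ρ • stPull (ρ ^ 2) ρ T x₀ u) (R (φ j) ^ 2 * (-4))) (R (φ j) • y) = _
    rw [curl_smul_stPull, smul_smul, smul_smul, e1, e2, e3]


end Summit.NavierStokesRegularity.NavierStokesRegularity.Theorems.StrainDoors

end
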